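import Summits.RiemannHypothesis.RiemannHypothesis.Theses.SpectralTrace
import Summits.RiemannHypothesis.RiemannHypothesis.Theorems.WindowTracePrime2.Negative.FiniteFamilies
import Summits.RiemannHypothesis.RiemannHypothesis.Theorems.WindowTracePrime2.Negative.LoadBearing
import Summits.RiemannHypothesis.RiemannHypothesis.Theorems.SpectralTracePickSlopeDefs
import Summits.RiemannHypothesis.RiemannHypothesis.Theorems.SpectralTraceWindowTracePrime2StubMassLaw
import Summits.RiemannHypothesis.RiemannHypothesis.Theorems.SpectralTraceWindowTracePrime2StubPickSlopeOfCrux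
import Literature.NumberTheory.LFunctions.WeilFirstPrimePositivityC
import HarnessLib

/-!
# Line `pick-slope` for the crux `SpectralTrace.WindowTracePrime2` (stmt-RiemannHypothesis-11196)

Crux (route decl, FIXED): `∃ (ι : Type) (γ : ι → ℝ), ∀ g, IsWeilTest g → tsupport g ⊆ [-log 3, log 3] →
HasSum (fun i ↦ ĝ(1/2 + iγ_i)) (W g)` — a real unit-multiplicity family reproducing the Weil
distribution on the window `(-log 3, log 3)` (only the prime power `2` enters).

Idea card `Cruxes/WindowTracePrime2/Ideas/pick-slope.md` (crux-ideate r1, ideator 2; triage r1: 3/3 pass,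
"honest conditional REFORMULATION"). LEVER: in the Kreĭn–Nevanlinna parametrisation of the (positive,
indeterminate) window-(log 3) extension problem by a real 2×2 resolvent matrix `(A B; C D)`, `AD - BC = 1`,
the solution attached to a MEROMORPHIC Herglotz parameter `τ` is purely atomic, its atoms are the crossings
`τ(t) = Θ(t) := -D(t)/C(t)` on `P¹(ℝ)` and its masses are `1/(κ + C²τ′)`, `κ := CD′ - C′D > 0`
(MASS LAW, from `det = 1`); so a witness of the crux is exactly a parameter whose SLOPE at every crossing is
`τ′ = (1/m - κ)/C²`, `m ∈ ℕ⁺` (unit mass: `m = 1`) — a boundary Nevanlinna–Pick problem with 1-jet data.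

This file: the vocabulary (landed as `Theorems/SpectralTracePickSlopeDefs.lean`: real-axis only, no complex analysis,
no measures — a solution is recorded by its atom set and point masses and the identity it satisfies is a `HasSum`),
the registered stubs, and the sorry-free composition
`WindowTracePrime2_of : stub_positivity → stub_resolvent → stub_massLaw → stub_pickSlope → WindowTracePrime2`
concluding the route decl BY NAME.

Registered stubs (sorry ONLY here; plus `stub_defs`, the definitions-file obligation added by the lead):
* `stub_positivity` — `WeilPositivityOn (log 3 / 2)`: the positivity half (= route WeilPos item
  `WeilposRungPrime2`, stmt-RiemannHypothesis-0100; shared, staffed there and by `one-signed-split`).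
* `stub_resolvent` — positivity ⇒ a NEVANLINNA PARAMETRISATION of the locally finite atomic solutions exists
  (Kreĭn–Langer / de Branges for the Weil window germ at `L = log 3`; the card's definition request D1).
* `stub_massLaw` — residues of `(Aτ + B)/(Cτ + D)` on the real axis (pure calculus from `det = 1`; RH-free,
  provable now).
* `stub_pickSlope` — the slope condition (★) is solvable with reciprocal-integer masses (the integrality half;
  RH-implied through `complete`; the line's bet).

Disproof used (`Cruxes/WindowTracePrime2/Disproof.lean`, cdisprove cycle 1): `windowTracePrime2_false_without_IsWeilTest`
is honoured at `Realises` (tests are `IsWeilTest`, the identity is the crux's own `HasSum`); realness is built in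
(`PickParam` is real-axis data of a Herglotz function: atoms are real) — `windowTracePrime2WithoutReal_holds`;
`not_trace_of_finite` / `finite_abs_le_of_trace` / `finite_fibre_of_trace` (landed, `Negative/FiniteFamilies`) are
the reason solutions are recorded as LOCALLY FINITE atom sets with finite integer multiplicities (`complete` asks
exactly that); `not_windowTracePrime2_progressions` is not engaged (no lattice is posited). No stub is an instance
of a landed `Negative/*` lemma (checked by importing `FiniteFamilies`, `LoadBearing` here).
-/

noncomputable section

open Complex Set Filter
open scoped Topology BigOperators

set_option linter.dupNamespace false

namespace Summit.RiemannHypothesis.RiemannHypothesis.Cruxes.WindowTracePrime2.PickSlope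

open Literature.NumberTheory.LFunctions
open Summit.RiemannHypothesis.RiemannHypothesis.Theses.SpectralTrace (WindowTracePrime2)
open Summit.RiemannHypothesis.RiemannHypothesis.Theorems.PickSlope

/-! ## Vocabulary

The line's vocabulary (`PickParam`, `Realises`, `Resolvent`, `Resolvent.IsNevanlinna` and their projections) LANDED
verbatim as `Theorems/SpectralTracePickSlopeDefs.lean` (p86202, namespace
`Summit.RiemannHypothesis.RiemannHypothesis.Theorems.PickSlope`, opened below) together with the sanity stub
`stub_defs`; the stubs and the composition refer to the landed declarations. -/

/-! ## The registered stubs (`sorry` lives only in these four theorems) -/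

/-- **STUB 0 · `stub_defs`** — the definitions-file obligation, LANDED (p86202): the resolvent data never
degenerate, `C(t) ≠ 0 ∨ D(t) ≠ 0`, from `det = 1`
(`Summit.RiemannHypothesis.RiemannHypothesis.Theorems.PickSlope.stub_defs`). [folklore] -/
theorem stub_defs : ∀ (R : Resolvent) (t : ℝ), R.C t ≠ 0 ∨ R.D t ≠ 0 :=
  Summit.RiemannHypothesis.RiemannHypothesis.Theorems.PickSlope.stub_defs

/-- **STUB 1 · `stub_positivity`** — the POSITIVITY HALF, LANDED (kernel-checked first-prime certificate
`Literature.NumberTheory.LFunctions.weilPositivityOn_log_three_half`, p123790; Summits copy p124253): first-prime Weil positivity on the half window,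
`Re W(h ⋆ h̃) ≥ 0` for `supp h ⊆ [-log 3/2, log 3/2]`; necessary for the crux (`WindowTraceToPositivity`,
landed) and equal to route WeilPos item `WeilposRungPrime2` (stmt-RiemannHypothesis-0100). OPEN, RH-implied;
float margin `< 6·10⁻⁸` (ConnesConsani2023 §2.3); `one-signed-split` reduces it to RH up to `~1e9` + a certified
floor. Size XL (shared; not this line's content). [cite: arXiv:2106.01715, §2.3] -/
theorem stub_positivity : WeilPositivityOn (Real.log 3 / 2) :=
  Literature.NumberTheory.LFunctions.weilPositivityOn_log_three_half

/-- **STUB 2 · `stub_resolvent`** — EXTEND: if the window datum is positive-definite then the locally finite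
atomic solutions of the window-`(log 3)` extension problem admit a Nevanlinna parametrisation by real-axis
resolvent data (existence of solutions: Kreĭn's extension theorem for positive-definite distributions on an
interval; resolvent matrix and description of ALL continuations: Kreĭn–Langer for the screw-function germ of
`ξ` via Suzuki's `G_g`; discrete solutions ↔ meromorphic parameters; `κ > 0` from `det W = 1` and the nesting
of Weyl discs). RH-free functional analysis GIVEN positivity; indeterminacy is derived inside (any solution has
local counts `≍ log T ≫` the Nyquist rate `L/π`). Size L–XL (the card's definition request D1 is its first
half). [cite: KreinLanger2013 (doi:10.1007/s00020-013-2091-z); arXiv:2206.03682, Thm 1.3 and Prop 3.1 (the window form is a Kreĭn continuation problem for the screw function of ξ)] -/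
theorem stub_resolvent :
    WeilPositivityOn (Real.log 3 / 2) → ∃ R : Resolvent, R.IsNevanlinna := by
  sorry

/-- **STUB 3 · `stub_massLaw`** — the MASS LAW, LANDED (p88231,
`Theorems/SpectralTraceWindowTracePrime2StubMassLaw.lean`): real-axis residues of `m_p` are `1/invMass` at
non-degenerate crossings and `0` elsewhere (RH-free calculus from `AD − BC = 1`). [folklore] -/
theorem stub_massLaw :
    ∀ (R : Resolvent) (p : Option PickParam) (x : ℝ),
      (x ∈ R.atoms p → R.invMass p x ≠ 0 →
        Tendsto (fun t => (x - t) * R.mfun p t) (𝓝[≠] x) (𝓝 (R.invMass p x)⁻¹)) ∧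
      (x ∉ R.atoms p → Tendsto (fun t => (x - t) * R.mfun p t) (𝓝[≠] x) (𝓝 0)) :=
  Summit.RiemannHypothesis.RiemannHypothesis.Theorems.PickSlope.stub_massLaw

/-- **STUB 4 · `stub_pickSlope`** — PICK THE SLOPE (★): for every Nevanlinna parametrisation of the
window-`(log 3)` problem some parameter `p` (a meromorphic Herglotz `τ`, or `∞`) has RECIPROCAL-INTEGER
predicted masses at all its crossings: `κ + C²τ′ = 1/m`, `m ∈ ℕ⁺` (unit atoms: `m = 1`, i.e.
`τ′ = (1 - κ)/C²`). The integrality half of the crux in slope coordinates; RH-implied (RH ⇒ the zeta ordinates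
realise the window with integer masses ⇒ labelled by `complete` ⇒ (★) by `residue` + STUB 3), and by
`complete` it suffices to exhibit ONE integer-atomic solution for ONE parametrisation. Obstruction map:
`κ ≤ 1/m` at every atom (Christoffel bound, landed `UnitMass.lean` at `A = log 3`); parameter count: square /
under-determined above `2πe^{2L} ≈ 56.5`, `≲ 7` stiff equations on `[18.85, 56.5]`. Size XL — the line's
bet and its HARDEST stub. [cite: arXiv:2106.01715, §2.3; Landau1967] -/
theorem stub_pickSlope :
    ∀ R : Resolvent, R.IsNevanlinna →
      ∃ (p : Option PickParam) (m : ℝ → ℕ), ∀ x ∈ R.atoms p, 0 < m x ∧ R.invMass p x = ((m x : ℝ))⁻¹ := by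
  sorry

/-- **STUB 5 · `stub_pickSlopeOfCrux`** — LOSSLESSNESS of the reformulation, LANDED (p88954,
`Summit.RiemannHypothesis.RiemannHypothesis.Theorems.PickSlope.stub_pickSlopeOfCrux`; added by the lead; the card's
"given STUBS 1–3, PickSlope ⟺ crux", direction ⇐, made a kernel-checkable obligation): the mass law and ANY
witness of the crux give, for every Nevanlinna parametrisation, a parameter with reciprocal-integer predicted
masses — regroup the witness over the fibres of `γ` (locally finite: landed `Negative.finite_abs_le_of_trace` /
`finite_fibre_of_trace`) into a positive-integer-weighted locally finite realisation, label it by `complete`,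
and identify `invMass` with `1/m` by `residue` + the mass law + uniqueness of punctured limits (`invMass > 0`
from `kappa_pos`, `c_pos`, `a_nonneg`). RH-free, provable now; size M. Not a hypothesis of
`WindowTracePrime2_of` (it certifies that STUB 4 is exactly crux-strength, no more). [folklore] -/
theorem stub_pickSlopeOfCrux :
    (∀ (R : Resolvent) (p : Option PickParam) (x : ℝ),
      (x ∈ R.atoms p → R.invMass p x ≠ 0 →
        Tendsto (fun t => (x - t) * R.mfun p t) (𝓝[≠] x) (𝓝 (R.invMass p x)⁻¹)) ∧
      (x ∉ R.atoms p → Tendsto (fun t => (x - t) * R.mfun p t) (𝓝[≠] x) (𝓝 0))) →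
    Summit.RiemannHypothesis.RiemannHypothesis.Theses.SpectralTrace.WindowTracePrime2 →
    ∀ R : Resolvent, R.IsNevanlinna →
      ∃ (p : Option PickParam) (m : ℝ → ℕ), ∀ x ∈ R.atoms p, 0 < m x ∧ R.invMass p x = ((m x : ℝ))⁻¹ :=
  Summit.RiemannHypothesis.RiemannHypothesis.Theorems.PickSlope.stub_pickSlopeOfCrux

namespace Registered

/-- Name-keyed statement of STUB 1 (hypothesis of `WindowTracePrime2_of`). [folklore] -/
abbrev stub_positivity : Prop := WeilPositivityOn (Real.log 3 / 2)

/-- Name-keyed statement of STUB 2. [folklore] -/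
abbrev stub_resolvent : Prop :=
  WeilPositivityOn (Real.log 3 / 2) → ∃ R : Resolvent, R.IsNevanlinna

/-- Name-keyed statement of STUB 3. [folklore] -/
abbrev stub_massLaw : Prop :=
  ∀ (R : Resolvent) (p : Option PickParam) (x : ℝ),
    (x ∈ R.atoms p → R.invMass p x ≠ 0 →
      Tendsto (fun t => (x - t) * R.mfun p t) (𝓝[≠] x) (𝓝 (R.invMass p x)⁻¹)) ∧
    (x ∉ R.atoms p → Tendsto (fun t => (x - t) * R.mfun p t) (𝓝[≠] x) (𝓝 0))

/-- Name-keyed statement of STUB 4. [folklore] -/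
abbrev stub_pickSlope : Prop :=
  ∀ R : Resolvent, R.IsNevanlinna →
    ∃ (p : Option PickParam) (m : ℝ → ℕ), ∀ x ∈ R.atoms p, 0 < m x ∧ R.invMass p x = ((m x : ℝ))⁻¹

end Registered

/-- The stubs ARE their registered statements (definitionally): the four `theorem stub_…` above elaborate
against the `Registered.stub_…` names keyed in the hypotheses of `WindowTracePrime2_of`. [folklore] -/
theorem stubs_are_registered :
    (Registered.stub_positivity ↔ WeilPositivityOn (Real.log 3 / 2)) ∧
    (Registered.stub_resolvent ↔ (WeilPositivityOn (Real.log 3 / 2) → ∃ R : Resolvent, R.IsNevanlinna)) ∧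
    (Registered.stub_massLaw ↔ ∀ (R : Resolvent) (p : Option PickParam) (x : ℝ),
      (x ∈ R.atoms p → R.invMass p x ≠ 0 →
        Tendsto (fun t => (x - t) * R.mfun p t) (𝓝[≠] x) (𝓝 (R.invMass p x)⁻¹)) ∧
      (x ∉ R.atoms p → Tendsto (fun t => (x - t) * R.mfun p t) (𝓝[≠] x) (𝓝 0))) ∧
    (Registered.stub_pickSlope ↔ ∀ R : Resolvent, R.IsNevanlinna →
      ∃ (p : Option PickParam) (m : ℝ → ℕ), ∀ x ∈ R.atoms p, 0 < m x ∧ R.invMass p x = ((m x : ℝ))⁻¹) :=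
  ⟨Iff.rfl, Iff.rfl, Iff.rfl, Iff.rfl⟩

/-! ## Sorry-free glue -/

/-- REGROUPING: a realisation with positive-integer weights `m` on `S` is a unit-multiplicity family on the
sigma type `Σ x : S, Fin (m x)` (absolute convergence in `ℂ` + `HasSum.sigma`). [folklore] -/
theorem hasSum_sigma_fin_of_hasSum_natMul {S : Type} (f : S → ℂ) (m : S → ℕ) {a : ℂ}
    (h : HasSum (fun x => (m x : ℂ) * f x) a) :
    HasSum (fun q : (Σ x : S, Fin (m x)) => f q.1) a := by
  set F : (Σ x : S, Fin (m x)) → ℂ := fun q => f q.1 with hF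
  have hfib : ∀ x : S, HasSum (fun j : Fin (m x) => F ⟨x, j⟩) ((m x : ℂ) * f x) := by
    intro x
    have h1 := hasSum_fintype (fun j : Fin (m x) => F ⟨x, j⟩)
    simp only [hF, Finset.sum_const, Finset.card_univ, Fintype.card_fin, nsmul_eq_mul] at h1
    exact h1
  have hn : Summable fun x => ‖(m x : ℂ) * f x‖ := summable_norm_iff.mpr h.summable
  have hnorm : Summable fun q => ‖F q‖ := by
    rw [summable_sigma_of_nonneg (fun _ => norm_nonneg _)]
    refine ⟨fun x => (hasSum_fintype _).summable, ?_⟩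
    refine hn.congr fun x => ?_
    simp only [hF, tsum_fintype, Finset.sum_const, Finset.card_univ, Fintype.card_fin, nsmul_eq_mul,
      norm_mul, Complex.norm_natCast]
  have hFsum : HasSum F (∑' q, F q) := hnorm.of_norm.hasSum
  have hG : HasSum (fun x : S => (m x : ℂ) * f x) (∑' q, F q) := hFsum.sigma hfib
  have heq : ∑' q, F q = a := hG.unique h
  rw [← heq]
  exact hFsum

/-- **`WindowTracePrime2_of`** — STUBS 2, 4 ⇒ the crux, BY NAME (STUB 1, first-prime positivity, and STUB 3,
the mass law, are landed and discharged inside). Positivity (1) feeds the parametrisation (2);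
pick the parameter `p` with reciprocal-integer predicted masses (4); by the residue description of `μ_p` (2)
and the mass law (3), uniqueness of punctured limits identifies the atoms of `μ_p` with the crossings and its
masses with the integers `m`; the realisation identity of `μ_p` (2) regrouped on `Σ x, Fin (m x)` is a witness.
[folklore] -/
theorem WindowTracePrime2_of (h₂ : Registered.stub_resolvent) (h₄ : Registered.stub_pickSlope) :
    Summit.RiemannHypothesis.RiemannHypothesis.Theses.SpectralTrace.WindowTracePrime2 := by
  have h₁ : Registered.stub_positivity := stub_positivity   -- STUB 1 is landed (p123790): discharged here
  have h₃ : Registered.stub_massLaw := stub_massLaw   -- STUB 3 is landed (p88231): discharged here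
  obtain ⟨R, hR⟩ := h₂ h₁
  obtain ⟨p, m, hm⟩ := h₄ R hR
  -- the atoms of `μ_p` are crossings, with masses `m`
  have key : ∀ x ∈ R.supp p, x ∈ R.atoms p ∧ R.mass p x = (m x : ℝ) := by
    intro x hx
    have hres := hR.residue p x
    rw [Set.indicator_of_mem hx] at hres
    by_cases hxa : x ∈ R.atoms p
    · obtain ⟨hmpos, hinv⟩ := hm x hxa
      have h0 : R.invMass p x ≠ 0 := by
        rw [hinv]
        exact inv_ne_zero (by exact_mod_cast hmpos.ne')
      have hlim := (h₃ R p x).1 hxa h0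
      refine ⟨hxa, ?_⟩
      have := tendsto_nhds_unique hres hlim
      rw [this, hinv, inv_inv]
    · have hlim := (h₃ R p x).2 hxa
      have h0 : R.mass p x = 0 := tendsto_nhds_unique hres hlim
      exact absurd h0 (hR.mass_pos p x hx).ne'
  -- the witness: atoms of `μ_p` repeated `m` times
  refine ⟨(Σ x : R.supp p, Fin (m x)), fun q => (q.1 : ℝ), fun g hg hsupp => ?_⟩
  have hreal := hR.realises p g hg hsupp
  have hcongr : (fun x : R.supp p => ((R.mass p x : ℝ) : ℂ) * weilMellin g (1 / 2 + ((x : ℝ) : ℂ) * I)) =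
      fun x : R.supp p => ((m x : ℕ) : ℂ) * weilMellin g (1 / 2 + ((x : ℝ) : ℂ) * I) := by
    funext x
    rw [(key x x.2).2]
    push_cast
    rfl
  rw [hcongr] at hreal
  exact hasSum_sigma_fin_of_hasSum_natMul
    (fun x : R.supp p => weilMellin g (1 / 2 + ((x : ℝ) : ℂ) * I)) (fun x => m x) hreal

/-- The sorried stubs inhabit the registered names (so the skeleton composes today, modulo `sorry`). [folklore] -/
example : Summit.RiemannHypothesis.RiemannHypothesis.Theses.SpectralTrace.WindowTracePrime2 :=
  WindowTracePrime2_of stub_resolvent stub_pickSlope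

end Summit.RiemannHypothesis.RiemannHypothesis.Cruxes.WindowTracePrime2.PickSlope
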